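import Summits.ResolutionOfSingularities.ResolutionOfSingularities.Theorems.RadicialJungCleanModelsLens5KbarCossart
import Literature.AlgebraicGeometry.Resolution.CossartFunctionNormalForm3
import Literature.AlgebraicGeometry.Motives.RatFnSpec
import HarnessLib

/-!
# Route `RadicialJung`, crux `CleanModels` (stmt-15917): the `k = k̄` slice of the LOCAL-UNIFORMIZATION node `cleanLU3_of_stubs`
# from the RATIONAL twin `Cossart1987ThmRational` of F-112 — so that a re-lined skeleton can key stub 3 on ONE name from Cossart 1987 /
# Posva 2024 serving BOTH the global `k̄` branch (`…KbarRationalOfCossart1987.lean`) and the `k̄` case inside the research residue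

Explicit-unit seat `decomp-res-hand-1` g22.  OURS, def-free, counted 0.  Nothing here proves resolution in characteristic `p`; the printed theorem
`Cossart1987ThmRational` (✓-typed, `Literature/AlgebraicGeometry/Resolution/CossartFunctionNormalForm3.lean`, Posva 2024 Claim 5.1.2 / App. A §A.7)
is bound as a hypothesis.

* `nuZeroAlongValuation_of_cossartRational` — Cossart/Posva GLOBAL ⟹ Cossart's `ν = 0` along a zero-dimensional valuation for SOME representative
  `g₀ v^p` (`v ≠ 0`) of the `K^p`-multiples of `g₀`: the plumbing of ✓ `Lens5.KbarCossart.nuZeroAlongValuation_of_cossart1987Thm` (regular affine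
  model, Cossart on `Spec A₁`, valuative criterion + extraction ✓ `exists_model_of_proper_birational`, transport along `δ : 𝒪_{X',x} ≅ locAtCentre T O`)
  with the radicand read in `K(Spec A₁)` through `IsLocalization.algEquiv` and the identification `Θ ∘ π^♯ = (K(Spec A₁) ≅ K)` on ALL of `K(Spec A₁)`
  (`IsLocalization.ringHom_ext`), not only on global sections.
* `cleanLU3_algClosed_of_cossartRational` — the statement of ✓ `Lens5.KbarCossart.cleanLU3_algClosed_of_cossart1987Thm` VERBATIM with
  `Cossart1987Thm` replaced by `Cossart1987ThmRational`.
* `cleanLU3DefectNonDiscrete_algClosed_of_cossartRational` — the consumer shape of ✓ `Lens5.KbarCossart.cleanLU3DefectNonDiscrete_algClosed_of_cossart1987Thm`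
  (Sketch rev 26 :249 + `[IsAlgClosed k]`) VERBATIM over the rational twin.

RE-LINING NOTE (lead): with these, `stub_cossart1987Thm : Cossart1987Thm` (F-112) can be replaced by `stub_cossart1987ThmRational : Cossart1987ThmRational`
at NO change of stub count — the new stub 3 feeds `cleanLU3DefectNonDiscrete_of_stubs` (its `IsAlgClosed k` case, through this file) AND a top-level
`by_cases (IsAlgClosed k ∧ IsQuasiProjectiveOver f)` in the dim-`≤ 3` branch closed by ✓ `KbarRational.cleanModelsAt_quasiProjective_dimThree_algClosed_of_cossartRational`
(no LU, no patching there).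
-/

noncomputable section

set_option linter.dupNamespace false

open IsLocalRing
open Literature.AlgebraicGeometry.Resolution
open Summit.ResolutionOfSingularities.ResolutionOfSingularities.Theorems.RadicialJung.CleanModels
open Summit.ResolutionOfSingularities.ResolutionOfSingularities.Theorems.RadicialJung.CleanModels.Lens5.KbarCossart
open Literature.RingTheory.PBasis
open CategoryTheory AlgebraicGeometry TopologicalSpace
open Literature.AlgebraicGeometry.CossartPiltant200819.CP2008
open Literature.AlgebraicGeometry.Motives

namespace Summit.ResolutionOfSingularities.ResolutionOfSingularities.Theorems.RadicialJung.CleanModels.KbarRational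

/-- **Cossart/Posva GLOBAL ⟹ Cossart's `ν = 0` along a zero-dimensional valuation, `k = k̄`, for a representative `g₀ v^p` of the line of `g₀`.**
For `k` algebraically closed of characteristic `p`, a finitely generated `k`-model `A ⊆ O` of `K`, regular of dimension `3` at the (closed) centre of
the zero-dimensional valuation ring `O`, and `g₀ ∈ K ∖ K^p`, there are a finitely generated `A' ⊇ A` inside `O`, regular at the centre, and `v ∈ K`,
`v ≠ 0`, with `g₀ v^p ∈ locAtCentre A' O` and `NuZeroAt (g₀ v^p)` there.  Proof: as ✓ `nuZeroAlongValuation_of_cossart1987Thm`, applying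
`Cossart1987ThmRational` to the rational function `u ↔ g₀` on the regular affine model `Spec A₁` and identifying `Θ ∘ π^♯` with `K(Spec A₁) ≅ K`
on the whole function field. [cite: Posva2024, Claim 5.1.2 and App. A §A.7] -/
theorem nuZeroAlongValuation_of_cossartRational (h : Cossart1987ThmRational) (p : ℕ) [Fact p.Prime]
    (k : Type) [Field k] [CharP k p] [IsAlgClosed k] (K : Type) [Field K] [Algebra k K]
    (O : ValuationSubring K) (A : Subalgebra k K) (hAO : A.toSubring ≤ O.toSubring) (hAfg : A.FG)
    (hfr : IsFractionRing A K) (hreg : IsRegularLocalRing (locAtCentre A.toSubring O))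
    (hdim3 : ringKrullDim (locAtCentre A.toSubring O) = 3)
    (hzd : ∀ (T : Subring K) (hT : T ≤ O.toSubring), A.toSubring ≤ T → (subringCentre T O hT).IsMaximal)
    (g₀ : K) (hg₀ : ∀ c : K, c ^ p ≠ g₀) :
    ∃ (A' : Subalgebra k K), A'.toSubring ≤ O.toSubring ∧ A ≤ A' ∧ A'.FG ∧
    ∃ (_ : IsRegularLocalRing (locAtCentre A'.toSubring O)) (v : K) (_ : v ≠ 0)
      (hf : g₀ * v ^ p ∈ locAtCentre A'.toSubring O),
      NuZeroAt (⟨g₀ * v ^ p, hf⟩ : ↥(locAtCentre A'.toSubring O)) := by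
  classical
  -- Step 1: a regular affine model `A₁ ⊇ A` inside `O`
  obtain ⟨A₁, hA₁O, hAA₁, hA₁fg, hfr₁, hregA₁, hdimA₁⟩ :=
    exists_regularAffineModel₃ k K O A hAO hAfg hfr hreg hdim3 (hzd _ hAO le_rfl)
  obtain ⟨s₁, rfl⟩ := hA₁fg
  set A₁ := Algebra.adjoin k (s₁ : Set K) with hA₁def
  haveI := hfr₁
  haveI : IsRegularRing A₁ := hregA₁
  haveI : Algebra.FiniteType k A₁ := A₁.fg_iff_finiteType.mp ⟨s₁, rfl⟩
  haveI : IsNoetherianRing A₁ := Algebra.FiniteType.isNoetherianRing k A₁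
  -- Step 2: the scheme `X = Spec A₁` over `k`
  let R : CommRingCat.{0} := CommRingCat.of A₁
  haveI : IsDomain R := inferInstanceAs (IsDomain A₁)
  haveI : IsRegularRing R := inferInstanceAs (IsRegularRing A₁)
  letI : Algebra R K := inferInstanceAs (Algebra A₁ K)
  haveI : IsFractionRing R K := inferInstanceAs (IsFractionRing A₁ K)
  let X : Scheme.{0} := Spec R
  let sX : X ⟶ Spec (.of k) := Spec.map (CommRingCat.ofHom (algebraMap k A₁))
  haveI : LocallyOfFiniteType sX := locallyOfFiniteType_Spec k A₁
  haveI : IsSeparated sX := inferInstanceAs (IsSeparated (Spec.map (CommRingCat.ofHom (algebraMap k A₁))))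
  have hXreg : Scheme.IsRegular X := Scheme.isRegular_Spec R
  have hXdim : topologicalKrullDim X = 3 :=
    (PrimeSpectrum.topologicalKrullDim_eq_ringKrullDim (R := A₁)).trans hdimA₁
  -- the radicand read in `K(X) ≅ K`
  haveI : IsFractionRing R (Spec R).functionField := functionField_isFractionRing_of_affine R
  let e₀ : (Spec R).functionField ≃ₐ[R] K := IsLocalization.algEquiv (nonZeroDivisors R) _ _
  let u : X.functionField := e₀.symm g₀
  have hu : ∀ c : X.functionField, c ^ p ≠ u := by
    intro c hc
    apply hg₀ (e₀ c)
    rw [← map_pow, hc]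
    exact e₀.apply_symm_apply g₀
  -- Step 3: Cossart/Posva on `(X, u)`
  have hXqp : IsQuasiProjectiveOver sX := isQuasiProjectiveOver_of_isAffine sX
  obtain ⟨X', π, hX'int, hdom, hπ, hX'reg, ⟨U, hUne, hUiso⟩, hν⟩ := h p k X sX hXqp hXreg hXdim u hu
  haveI := hπ
  haveI := hX'int
  haveI := hUiso
  obtain ⟨hbir, -⟩ := isBirational_and_denseRange π U hUne
  -- Step 4: extraction of a finitely generated model at the centre of `O` on `X'`
  obtain ⟨x, T, hTO, hTfg, δ, Θ, hΘδ, hΘπ⟩ :=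
    exists_model_of_proper_birational (A := A₁) (K := K) O (fun b => hA₁O b.2) π hπ hbir
  -- `Θ ∘ π^♯` is the canonical identification `K(X) ≅ K` (they agree on `A₁`)
  have hΘe : ∀ z : X.functionField, Θ (RatFn.functionFieldMap π z) = e₀ z := by
    have hext : (Θ.comp (RatFn.functionFieldMap π)) = (e₀ : X.functionField →+* K) := by
      refine IsLocalization.ringHom_ext (nonZeroDivisors R) ?_
      ext a
      have hea : (e₀ : (Spec R).functionField →+* K) (algebraMap R (Spec R).functionField a) = algebraMap R K a :=
        e₀.commutes a
      have hga : algebraMap R (Spec R).functionField a =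
          (Spec R).presheaf.germ ⊤ (genericPoint (Spec R)) trivial ((Scheme.ΓSpecIso R).inv a) :=
        RatFn.algebraMap_functionField_Spec R a
      have hΘa : Θ (RatFn.functionFieldMap π (algebraMap R (Spec R).functionField a)) = algebraMap R K a := by
        rw [hga, hΘπ]
        change algebraMap A₁ K ((Scheme.ΓSpecIso R).hom ((Scheme.ΓSpecIso R).inv a)) = _
        rw [← CommRingCat.comp_apply, Iso.inv_hom_id, CommRingCat.id_apply]
      show Θ (RatFn.functionFieldMap π (algebraMap R (Spec R).functionField a)) =
        (e₀ : (Spec R).functionField →+* K) (algebraMap R (Spec R).functionField a)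
      rw [hΘa, hea]
    intro z
    exact RingHom.congr_fun hext z
  -- Step 5: the representative `u v'^p` with `ν = 0` at `x`, carried to `g₀ v^p`
  obtain ⟨v', g, hv', hg, hN⟩ := hν x
  let v : K := e₀ v'
  have hv : v ≠ 0 := fun h0 => hv' (by simpa [v] using h0)
  have hgx : ((δ g : ↥(locAtCentre T.toSubring O)) : K) = g₀ * v ^ p := by
    rw [← hΘδ, hg, hΘe, map_mul, map_pow]
    change e₀ (e₀.symm g₀) * v ^ p = _
    rw [e₀.apply_symm_apply]
  -- Step 6: `g₀ v^p ∈ locAtCentre T O`, regular, `ν = 0` there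
  have hfT : g₀ * v ^ p ∈ locAtCentre T.toSubring O := by rw [← hgx]; exact (δ g).2
  haveI hregT : IsRegularLocalRing (locAtCentre T.toSubring O) := by
    haveI := hX'reg x
    exact IsRegularLocalRing.of_ringEquiv δ
  have hνT : NuZeroAt (⟨g₀ * v ^ p, hfT⟩ : ↥(locAtCentre T.toSubring O)) := by
    have h1 := nuZeroAt_of_ringEquiv δ hN
    have heq : δ g = ⟨g₀ * v ^ p, hfT⟩ := Subtype.ext hgx
    rwa [heq] at h1
  -- Step 7: re-base `T` over `k`
  obtain ⟨t, ht⟩ := hTfg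
  have e : (Algebra.adjoin k ((s₁ : Set K) ∪ (t : Set K))).toSubring = T.toSubring := by
    rw [Algebra.adjoin_union_eq_adjoin_adjoin, ← ht]; rfl
  refine ⟨Algebra.adjoin k ((s₁ : Set K) ∪ (t : Set K)), ?_, ?_, ⟨s₁ ∪ t, by push_cast; rfl⟩, ?_⟩
  · rw [e]; exact hTO
  · exact hAA₁.trans (Algebra.adjoin_mono Set.subset_union_left)
  · obtain ⟨hr, hf, hn⟩ := nuZeroAtCentre_of_toSubring_eq O e (g₀ * v ^ p) ⟨hregT, hfT, hνT⟩
    exact ⟨hr, v, hv, hf, hn⟩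

/-- **THE `k̄`-SLICE OF THE NODE `cleanLU3_of_stubs` MODULO THE RATIONAL TWIN ALONE**: the statement of
✓ `Lens5.KbarCossart.cleanLU3_algClosed_of_cossart1987Thm` VERBATIM with the hypothesis `Cossart1987Thm` (F-112) replaced by `Cossart1987ThmRational`
(Posva 2024 Claim 5.1.2): take the chart and the representative `f := g₀ v^p` of `nuZeroAlongValuation_of_cossartRational`, read off a loosely clean
`c₀^p + c₁^p f` by ✓ `looseCleanRep_of_nuZeroAt` (LEMMA G), repackage with `c := (c₀, c₁ v, 0, …, 0)` (✓ `concl_of_looseCleanRep`).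
[cite: Posva2024, Claim 5.1.2 and App. A §A.7] -/
theorem cleanLU3_algClosed_of_cossartRational (p : ℕ) (h : Cossart1987ThmRational) :
    p.Prime →
    ∀ (k : Type) [Field k] [CharP k p] [IsAlgClosed k] (K : Type) [Field K] [Algebra k K]
    (O : ValuationSubring K) (A : Subalgebra k K), A.toSubring ≤ O.toSubring → A.FG → IsFractionRing A K →
    ringKrullDim A ≤ 3 → IsRegularLocalRing (locAtCentre A.toSubring O) →
    ringKrullDim (locAtCentre A.toSubring O) = 3 →
    (∀ (T : Subring K) (hT : T ≤ O.toSubring), A.toSubring ≤ T → (subringCentre T O hT).IsMaximal) →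
    ∀ g₀ : K, (∀ c : K, c ^ p ≠ g₀) →
    ∃ (A' : Subalgebra k K), A'.toSubring ≤ O.toSubring ∧ A ≤ A' ∧ A'.FG ∧
    ∃ (_ : IsRegularLocalRing (locAtCentre A'.toSubring O)) (c : Fin p → K), (∃ j : Fin p, (j : ℕ) ≠ 0 ∧ c j ≠ 0) ∧
    ((∃ (d m : ℕ) (hmd : m ≤ d) (t : Fin d → ↥(locAtCentre A'.toSubring O)) (a : Fin m → ℕ) (u : ↥(locAtCentre A'.toSubring O)), IsUnit u ∧
    Ideal.span (Set.range t) = IsLocalRing.maximalIdeal ↥(locAtCentre A'.toSubring O) ∧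
    ringKrullDim ↥(locAtCentre A'.toSubring O) = (d : WithBot ℕ∞) ∧ 0 < m ∧ (∀ i, ¬ p ∣ a i) ∧
    (∑ j : Fin p, c j ^ p * g₀ ^ (j : ℕ)) = (u : K) * ∏ i : Fin m, ((t (Fin.castLE hmd i) : ↥(locAtCentre A'.toSubring O)) : K) ^ (a i)) ∨
    (∃ u : ↥(locAtCentre A'.toSubring O), IsUnit u ∧ (∑ j : Fin p, c j ^ p * g₀ ^ (j : ℕ)) = (u : K) ∧
    ∀ c' : ↥(locAtCentre A'.toSubring O), u - c' ^ p ∉ IsLocalRing.maximalIdeal ↥(locAtCentre A'.toSubring O)) ∨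
    (∃ s c' : ↥(locAtCentre A'.toSubring O), (∑ j : Fin p, c j ^ p * g₀ ^ (j : ℕ)) = (s : K) ∧
    s - c' ^ p ∈ IsLocalRing.maximalIdeal ↥(locAtCentre A'.toSubring O) ∧
    s - c' ^ p ∉ IsLocalRing.maximalIdeal ↥(locAtCentre A'.toSubring O) ^ 2)) := by
  intro hp k _ _ _ K _ _ O A hAO hAfg hfrac _hdimA hreg hdim3 hzd g₀ hg₀
  classical
  haveI : Fact p.Prime := ⟨hp⟩
  haveI := hfrac
  obtain ⟨A', hA'O, hAA', hA'fg, hreg', v, hv, hfS, hN'⟩ :=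
    nuZeroAlongValuation_of_cossartRational h p k K O A hAO hAfg hfrac hreg hdim3 hzd g₀ hg₀
  have hf : ∀ c : K, c ^ p ≠ g₀ * v ^ p := by
    intro c hc
    apply hg₀ (c / v)
    rw [div_pow, hc, mul_div_assoc, div_self (pow_ne_zero _ hv), mul_one]
  haveI : IsFractionRing A' K := isFractionRing_of_le' hAA'
  have hmax : (subringCentre A'.toSubring O hA'O).IsMaximal := hzd A'.toSubring hA'O (fun x hx => hAA' hx)
  haveI : IsRegularLocalRing ↥(locAtCentre A'.toSubring O) := hreg'
  have hrep := looseCleanRep_of_nuZeroAt p k K O A' hA'O hA'fg inferInstance hmax hreg' (g₀ * v ^ p) hfS hf hN'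
  have hcomm : g₀ * v ^ p = v ^ p * g₀ := mul_comm _ _
  rw [hcomm] at hrep
  exact concl_of_looseCleanRep (hreg' := hreg') hp O A A' hA'O hAA' hA'fg g₀ v hv hrep

/-- **Sketch rev 26 :249 `stub_cleanLU3DefectNonDiscrete` + `[IsAlgClosed k]`, modulo the RATIONAL twin alone** — the consumer shape of
✓ `Lens5.KbarCossart.cleanLU3DefectNonDiscrete_algClosed_of_cossart1987Thm` VERBATIM over `Cossart1987ThmRational` (discard the five valuation-class
hypotheses). [cite: Posva2024, Claim 5.1.2 and App. A §A.7] -/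
theorem cleanLU3DefectNonDiscrete_algClosed_of_cossartRational (p : ℕ) (h : Cossart1987ThmRational) :
    p.Prime →
    ∀ (k : Type) [Field k] [CharP k p] [IsAlgClosed k] (K : Type) [Field K] [Algebra k K]
    (O : ValuationSubring K) (A : Subalgebra k K), A.toSubring ≤ O.toSubring → A.FG → IsFractionRing A K →
    ringKrullDim A ≤ 3 → IsRegularLocalRing (locAtCentre A.toSubring O) →
    ringKrullDim (locAtCentre A.toSubring O) = 3 →
    (∀ (T : Subring K) (hT : T ≤ O.toSubring), A.toSubring ≤ T → (subringCentre T O hT).IsMaximal) →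
    ∀ g₀ : K, (∀ c : K, c ^ p ≠ g₀) →
    (∀ f₀ : K, ∃ f₁ : K, O.valuation (g₀ - f₁ ^ p) < O.valuation (g₀ - f₀ ^ p)) →
    (∀ hk : ∀ c : k, algebraMap k K c ∈ O, transcendenceDefect k O hk ≠ 0) →
    ¬ (∃ π : K, π ≠ 0 ∧ (∀ x : K, O.valuation x < 1 → O.valuation x ≤ O.valuation π) ∧
      (∀ x : K, x ≠ 0 → ∃ n : ℕ, O.valuation π ^ n ≤ O.valuation x)) →
    ¬ (∃ (O₁ : ValuationSubring K), O ≤ O₁ ∧ O₁ ≠ ⊤ ∧ ∃ y : Fin 2 → K, (∀ i, y i ∈ O) ∧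
      ∀ P : MvPolynomial (Fin 2) k, P ≠ 0 → O₁.valuation (MvPolynomial.aeval y P) = 1) →
    ¬ (PerfectField k ∧ ∃ x y : K, x ≠ 0 ∧ y ≠ 0 ∧ ∀ a b : ℕ, a < p → b < p → (a ≠ 0 ∨ b ≠ 0) →
      ∀ z : K, z ≠ 0 → O.valuation (x ^ a * y ^ b) ≠ O.valuation (z ^ p)) →
    ∃ (A' : Subalgebra k K), A'.toSubring ≤ O.toSubring ∧ A ≤ A' ∧ A'.FG ∧
    ∃ (_ : IsRegularLocalRing (locAtCentre A'.toSubring O)) (c : Fin p → K), (∃ j : Fin p, (j : ℕ) ≠ 0 ∧ c j ≠ 0) ∧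
    ((∃ (d m : ℕ) (hmd : m ≤ d) (t : Fin d → ↥(locAtCentre A'.toSubring O)) (a : Fin m → ℕ) (u : ↥(locAtCentre A'.toSubring O)), IsUnit u ∧
    Ideal.span (Set.range t) = IsLocalRing.maximalIdeal ↥(locAtCentre A'.toSubring O) ∧
    ringKrullDim ↥(locAtCentre A'.toSubring O) = (d : WithBot ℕ∞) ∧ 0 < m ∧ (∀ i, ¬ p ∣ a i) ∧
    (∑ j : Fin p, c j ^ p * g₀ ^ (j : ℕ)) = (u : K) * ∏ i : Fin m, ((t (Fin.castLE hmd i) : ↥(locAtCentre A'.toSubring O)) : K) ^ (a i)) ∨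
    (∃ u : ↥(locAtCentre A'.toSubring O), IsUnit u ∧ (∑ j : Fin p, c j ^ p * g₀ ^ (j : ℕ)) = (u : K) ∧
    ∀ c' : ↥(locAtCentre A'.toSubring O), u - c' ^ p ∉ IsLocalRing.maximalIdeal ↥(locAtCentre A'.toSubring O)) ∨
    (∃ s c' : ↥(locAtCentre A'.toSubring O), (∑ j : Fin p, c j ^ p * g₀ ^ (j : ℕ)) = (s : K) ∧
    s - c' ^ p ∈ IsLocalRing.maximalIdeal ↥(locAtCentre A'.toSubring O) ∧
    s - c' ^ p ∉ IsLocalRing.maximalIdeal ↥(locAtCentre A'.toSubring O) ^ 2)) := by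
  intro hp k _ _ _ K _ _ O A hAO hAfg hfrac hdimA hreg hdim3 hzd g₀ hg₀ _ _ _ _ _
  exact cleanLU3_algClosed_of_cossartRational p h hp k K O A hAO hAfg hfrac hdimA hreg hdim3 hzd g₀ hg₀

end Summit.ResolutionOfSingularities.ResolutionOfSingularities.Theorems.RadicialJung.CleanModels.KbarRational

end
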